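import Mathlib
import Summits.Ventures.PercRepro2.TypedBundleCutRoots
import Summits.Ventures.PercRepro2.TypedSixRung

/-!
# The rung `|F| = 6` as a named hypothesis, and the domain at `|F| ≥ 7` (blind cell PercRepro2,
p2 g2, 2026-08-25; sub-claim S1 (B) of ASSIGNMENTS v12.61 — the composition on night-3 g7's rung)

night-3 g7's target (INBOX 05:37:27Z, approved 05:40:30Z (2)): row 2′TRI at `z ≡ false` on every
fully reduced typed graph with `MarksDistinct` marks and exactly six typed edges, as a kernel theorem
by symmetry-reduced enumeration — the Prop **`SixRung R`** of TypedSixRung.lean, a THEOREM there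
(`sixRung_holds`, on night-3's SixTypedAll).  The residual class drops to `|F| ≥ 7`:

* **`ResidualCore7 := ResidualCore ∧ 7 ≤ |F|`**, **`HCov_all_of_residualCore7_all (h6 : SixRung R)`**
  and its UNCONDITIONAL form **`HCov_all_of_residualCore7_all'`** (by `sixRung_holds`);
* **`ResidualCoreFull7 := ResidualCoreFull ∧ 7 ≤ |F|`**, **`HCov_all_of_residualCoreFull7_all
  (h6 : SixRung R) (h3 : StarCerts R) (h4 : StarCertsGen R)`** — the domain with every
  subtraction of S1 and the rung, conditional on the two certificate bundles
  (**`HCov_all_of_residualCoreFull7_all'`** takes `h3 h4` only).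

Own code; standard axioms.
-/

namespace Summit.Ventures.PercRepro2

open UnionCluster

namespace CovForm

namespace TypedRed

section Core

variable {V : Type*} {E : Type*} [DecidableEq V] [Fintype E] [DecidableEq E]

/-- **The core at `|F| ≥ 7`.** -/
structure ResidualCore7 (ends : E → Sym2 V) (o a₁ a₂ a₃ b : V) (F : Finset E) : Prop where
  core : ResidualCore ends o a₁ a₂ a₃ b F
  seven_le : 7 ≤ F.card

/-- **The full residual core at `|F| ≥ 7`.** -/
structure ResidualCoreFull7 (ends : E → Sym2 V) (o a₁ a₂ a₃ b : V) (F : Finset E) : Prop where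
  full : ResidualCoreFull ends o a₁ a₂ a₃ b F
  seven_le : 7 ≤ F.card

end Core

section Closure

variable (R : Type*) [Field R] [LinearOrder R] [IsStrictOrderedRing R]

/-- **Row 2′TRI on `ResidualCore7`, over every finite graph.** -/
def ResidualCore7_all : Prop :=
  ∀ (V E : Type) [Fintype V] [DecidableEq V] [Fintype E] [DecidableEq E]
    (ends : E → Sym2 V) (o a₁ a₂ a₃ b : V) (F : Finset E) (τ : E → ℕ),
    (∀ e ∈ F, τ e = 1 ∨ τ e = 2) → ResidualCore7 ends o a₁ a₂ a₃ b F →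
      0 ≤ typedCount F (fun _ => false) τ
        (K3 ends o a₁ a₂ a₃ b : Config E → Config E → Config E → R)

/-- **Row 2′TRI on `ResidualCoreFull7`, over every finite graph.** -/
def ResidualCoreFull7_all : Prop :=
  ∀ (V E : Type) [Fintype V] [DecidableEq V] [Fintype E] [DecidableEq E]
    (ends : E → Sym2 V) (o a₁ a₂ a₃ b : V) (F : Finset E) (τ : E → ℕ),
    (∀ e ∈ F, τ e = 1 ∨ τ e = 2) → ResidualCoreFull7 ends o a₁ a₂ a₃ b F →
      0 ≤ typedCount F (fun _ => false) τ
        (K3 ends o a₁ a₂ a₃ b : Config E → Config E → Config E → R)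

/-- A residual instance has six or at least seven typed edges. -/
theorem six_or_seven_le {V E : Type*} [DecidableEq V] [Fintype E] [DecidableEq E]
    {ends : E → Sym2 V} {o a₁ a₂ a₃ b : V} {F : Finset E} (h : Residual ends o a₁ a₂ a₃ b F) :
    F.card = 6 ∨ 7 ≤ F.card := by
  have := h.six_le
  omega

/-- **CONDITIONAL on the rung: the crux of record from (TRI) on the core at `|F| ≥ 7`.** -/
theorem HCov_all_of_residualCore7_all (h6 : SixRung R) (hc : ResidualCore7_all R) : HCov_all R := by
  refine HCov_all_of_residualCore_all R ?_
  intro V E _ _ _ _ ends o a₁ a₂ a₃ b F τ hτ hcore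
  rcases six_or_seven_le hcore.residualConR.residualCon.residual with h | h
  · exact h6 V E ends o a₁ a₂ a₃ b F τ hcore.residualConR.residualCon.residual.reduced hcore.marks h hτ
  · exact hc V E ends o a₁ a₂ a₃ b F τ hτ ⟨hcore, h⟩

/-- **CONDITIONAL on the rung and the two certificate bundles: the crux of record from (TRI) on the
full residual core at `|F| ≥ 7`.** -/
theorem HCov_all_of_residualCoreFull7_all (h6 : SixRung R) (h3 : StarCerts R) (h4 : StarCertsGen R)
    (hc : ResidualCoreFull7_all R) : HCov_all R := by
  refine HCov_all_of_residualCoreFull_all R h3 h4 ?_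
  intro V E _ _ _ _ ends o a₁ a₂ a₃ b F τ hτ hfull
  have hcore := hfull.coreNHatC.coreNHat.core
  rcases six_or_seven_le hcore.residualConR.residualCon.residual with h | h
  · exact h6 V E ends o a₁ a₂ a₃ b F τ hcore.residualConR.residualCon.residual.reduced hcore.marks h hτ
  · exact hc V E ends o a₁ a₂ a₃ b F τ hτ ⟨hfull, h⟩

/-- **The crux of record from (TRI) on the core at `|F| ≥ 7`** — UNCONDITIONAL (the rung is a
theorem, `sixRung_holds`). -/
theorem HCov_all_of_residualCore7_all' (hc : ResidualCore7_all R) : HCov_all R :=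
  HCov_all_of_residualCore7_all R (sixRung_holds R) hc

/-- **The crux of record from (TRI) on the full residual core at `|F| ≥ 7`**, conditional on the
two certificate bundles only. -/
theorem HCov_all_of_residualCoreFull7_all' (h3 : StarCerts R) (h4 : StarCertsGen R)
    (hc : ResidualCoreFull7_all R) : HCov_all R :=
  HCov_all_of_residualCoreFull7_all R (sixRung_holds R) h3 h4 hc

end Closure

end TypedRed

end CovForm

end Summit.Ventures.PercRepro2
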